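import Summits.QuantumFields.BalabanUV.Beta.FP.TowerK2bStoreyBridge

/-!
# `BalabanUV.Beta.FP.TowerK2bDefectSplit` — road «FP», binder row D1, ROUTE T (β1): **THE WARD DEFECT SPLITS AS «COMMUTATOR + ROOT TERM + LOWER DEFECTS»**
# (`g48/SPEC-61.md` §3′; the road bridge `TowerK2bStoreyBridge.storeyRow_eq_commutator_add_remainder` read backwards, solved for the defect)

WHY.  The END wrappers v8∕v9 (`FP/StepRecursionFeedNestedNamedG∕H`) display ONE residual row (J-R₂″): the symmetrised `Ŝ`-contraction of the Ward DEFECT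
`Def(λ) := Σ_s λ s • Rs s`, `Rs` the explicit transport-variation remainder of `TowerK2bStoreyBridge` §0a (K-bridge `TowerK2bStoreyBridgeTwo.def_depthTwo ∕ def_succ`);
by value (Engine C K2L-C) that contraction is NOT zero at n = 0 at the road's read-outs (Q-FP-47-1, law-level).  THIS FILE names, over the bridge's displayed letters
and with no hypothesis at all, the two pieces the defect is made of — so that the row (Q-FP-48-1) and Engine C (R-FP-48 (i)) can say WHICH piece carries the residual:
**`defect_eq_commutator_add_root`**: `Σ_s λ s • (w • Σ_{b₁b₂} h b₁ b₂ • ((𝟙[pr·=s] − 𝟙[rt b₁=s])·L b₁ ⊗ L b₂ − L b₁ ⊗ (𝟙[pr·=s] − 𝟙[rt b₂=s])·L b₂) + Σ_b ℓ b • Rl s b)`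
`= w • (E_λ·B − B·E_λ) + w • Σ_{b₁b₂} ((λ (rt b₂) − λ (rt b₁))·h b₁ b₂) • L b₁ ⊗ L b₂ + Σ_b ℓ b • Σ_s λ s • Rl s b`,
`E_λ := diagonal (λ ∘ pr)`, `B := Σ_{b₁b₂} h b₁ b₂ • L b₁ ⊗ L b₂` (the brick-weighted transport table).  The FIRST piece is a plain commutator with the finest diagonal
generator — exactly what #21's congruence door (`k2`'s `−2XᵀH₁ + 2H₁X`) produces from any sector of `H₁`; the SECOND — brick-weighted differences of the gauge
function SAMPLED AT THE BRICK ROOTS — is the storeywise part ((W-lin)_m, an2 PART 32) that no plain conjugation by the finest generator produces; the THIRD is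
the lower storeys' defects through the linear brick `ℓ`.  `commutator_vecMulVec_sum` is the one matrix step (`[E, Σ h•u⊗v] = Σ h•((E u)⊗v − u⊗(vᵀE))`).
[folklore] `Matrix`∕`Finset` algebra BY NAME over abstract finite index types (the bridge's §0 letters VERBATIM); no `def`, nothing cited, 0 sorry; nothing of
Bałaban's asserted, valued or discharged; (J-R₂″) NOT claimed either way; 0∕4 row-D1 binders (hW ∕ hR ∕ D1Tel ∕ D1Rep); NOT (C1), NOT (T-ID), NOT D1, NEVER
«G-an2-4 closed», NOT BetaPertH, NOT continuum, NOT Clay.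
HONEST DEPENDENCY (page 1, mandatory): continuum YM on T⁴ ⇐ BetaPertH ∧ nine spine estimates (0/9 proved); BetaPertH ⇐ (D1) ∧ (D4) ∧ CAP+tail;
G-an2-4 gates asym, D1 and NE2/3/4.  HONEST FRAMING (cell contract, verbatim): «discharging `BetaPertH` makes Bałaban's UV stability UNCONDITIONAL —
a real constructive-QFT result; it is NOT the continuum limit and NOT the Clay problem.»  ABSOLUTE RULE (cell charter, verbatim): «No internally-minted
statement may enter as a cited fact. Every hypothesis is either kernel-proved in this package or a verbatim quotation of a PUBLISHED theorem with page
reference. The manuscript(s) under audit are NOT citable for their own disputed steps — they are the thing under adjudication; programme-internal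
(2001/route/tribunal) claims are never citable.»  Road «FP» OWNER, b2b-balaban-beta-d1-p3 gen 48, 2026-08-28.  No existing file touched.
-/

noncomputable section

open scoped BigOperators

namespace Summit.QuantumFields.BalabanUV.Beta.FP.TowerK2bDefectSplit

open Finset Matrix
open Summit.QuantumFields.BalabanUV.Beta.FP.TowerK2bStoreyBridge (diagonal_mul_vecMulVec vecMulVec_mul_diagonal sum_smul_vecMulVec_indicator_left
  sum_smul_vecMulVec_indicator_right sum_smul_top_add_low)

variable {ι σ τ : Type*} [Fintype ι] [DecidableEq ι] [Fintype σ] [DecidableEq σ] [Fintype τ]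

omit [Fintype σ] [DecidableEq σ] in
/-- [folklore] **the commutator of a diagonal with a brick-weighted sum of rank-one tables**:
`E·(Σ h•u⊗v) − (Σ h•u⊗v)·E = Σ h•((E·u⊗v) − (u⊗v·E))` termwise, each term a rescaled rank-one table. -/
theorem commutator_vecMulVec_sum (d : ι → ℝ) (h : τ → τ → ℝ) (L : τ → ι → ℝ) :
    Matrix.diagonal d * (∑ b₁, ∑ b₂, h b₁ b₂ • Matrix.vecMulVec (L b₁) (L b₂)) - (∑ b₁, ∑ b₂, h b₁ b₂ • Matrix.vecMulVec (L b₁) (L b₂)) * Matrix.diagonal d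
      = ∑ b₁, ∑ b₂, h b₁ b₂ • (Matrix.vecMulVec (fun x => d x * L b₁ x) (L b₂) - Matrix.vecMulVec (L b₁) (fun z => L b₂ z * d z)) := by
  simp only [Matrix.mul_sum, Matrix.sum_mul, Matrix.mul_smul, Matrix.smul_mul, diagonal_mul_vecMulVec, vecMulVec_mul_diagonal, smul_sub,
    Finset.sum_sub_distrib]

/-- [folklore] **`defect_eq_commutator_add_root` — THE WARD DEFECT = COMMUTATOR PART + ROOT-SAMPLED PART + LOWER DEFECTS** (no hypothesis; the bridge's §0 letters):
fine indices `ι` over sites `pr : ι → σ`, gauge function `λ : σ → ℝ`, top brick `h : τ → τ → ℝ` (any symmetry), transports `L : τ → ι → ℝ`, roots `rt : τ → σ`,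
linear brick `ℓ : τ → ℝ`, lower remainders `Rl`, weight `w`.  Summing the explicit remainder `Rs s` of `storeyRow_eq_commutator_add_remainder` against `λ`:
`Σ_s λ s • Rs s = w • [E_λ, B] + w • Σ_{b₁b₂} ((λ(rt b₂) − λ(rt b₁))·h b₁ b₂) • L b₁ ⊗ L b₂ + Σ_b ℓ b • Σ_s λ s • Rl s b`. -/
theorem defect_eq_commutator_add_root (pr : ι → σ) (lam : σ → ℝ) (h : τ → τ → ℝ) (L : τ → ι → ℝ) (rt : τ → σ) (ℓ : τ → ℝ)
    (Rl : σ → τ → Matrix ι ι ℝ) (w : ℝ) :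
    ∑ s, lam s • (w • ∑ b₁, ∑ b₂, h b₁ b₂ • (Matrix.vecMulVec (fun x => ((if pr x = s then (1 : ℝ) else 0) - (if rt b₁ = s then (1 : ℝ) else 0)) * L b₁ x) (L b₂)
              - Matrix.vecMulVec (L b₁) (fun z => ((if pr z = s then (1 : ℝ) else 0) - (if rt b₂ = s then (1 : ℝ) else 0)) * L b₂ z))
            + ∑ b, ℓ b • Rl s b)
      = w • (Matrix.diagonal (fun x => lam (pr x)) * (∑ b₁, ∑ b₂, h b₁ b₂ • Matrix.vecMulVec (L b₁) (L b₂))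
              - (∑ b₁, ∑ b₂, h b₁ b₂ • Matrix.vecMulVec (L b₁) (L b₂)) * Matrix.diagonal (fun x => lam (pr x)))
        + w • ∑ b₁, ∑ b₂, ((lam (rt b₂) - lam (rt b₁)) * h b₁ b₂) • Matrix.vecMulVec (L b₁) (L b₂)
        + ∑ b, ℓ b • ∑ s, lam s • Rl s b := by
  -- the gauge superposition enters termwise; each leg's indicator word is `E·P − λ(root)•P` ∕ `P·E − λ(root)•P`; the commutator is termwise too
  rw [sum_smul_top_add_low, commutator_vecMulVec_sum]
  simp only [smul_sub, Finset.sum_sub_distrib, sum_smul_vecMulVec_indicator_left, sum_smul_vecMulVec_indicator_right, diagonal_mul_vecMulVec,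
    vecMulVec_mul_diagonal]
  -- what is left is termwise scalar bookkeeping: `(EP − λ₁P) − (PE − λ₂P) = (EP − PE) + (λ₂ − λ₁)P`
  ext x z
  simp only [Matrix.add_apply, Matrix.sub_apply, Matrix.smul_apply, Matrix.sum_apply, Matrix.vecMulVec_apply, smul_eq_mul, Finset.mul_sum,
    Finset.sum_sub_distrib, mul_sub, sub_mul]
  simp only [mul_comm, mul_left_comm]
  abel

/-- [folklore] **the ROOT PART alone**, read the other way: it is the defect minus the commutator part minus the lower defects (the one line Engine C ∕ the row
need to split (J-R₂″)'s residual, `g48/SPEC-61.md` §3′ (i)). -/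
theorem root_eq_defect_sub_commutator (pr : ι → σ) (lam : σ → ℝ) (h : τ → τ → ℝ) (L : τ → ι → ℝ) (rt : τ → σ) (ℓ : τ → ℝ)
    (Rl : σ → τ → Matrix ι ι ℝ) (w : ℝ) :
    w • ∑ b₁, ∑ b₂, ((lam (rt b₂) - lam (rt b₁)) * h b₁ b₂) • Matrix.vecMulVec (L b₁) (L b₂)
      = ∑ s, lam s • (w • ∑ b₁, ∑ b₂, h b₁ b₂ • (Matrix.vecMulVec (fun x => ((if pr x = s then (1 : ℝ) else 0) - (if rt b₁ = s then (1 : ℝ) else 0)) * L b₁ x) (L b₂)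
              - Matrix.vecMulVec (L b₁) (fun z => ((if pr z = s then (1 : ℝ) else 0) - (if rt b₂ = s then (1 : ℝ) else 0)) * L b₂ z))
            + ∑ b, ℓ b • Rl s b)
        - w • (Matrix.diagonal (fun x => lam (pr x)) * (∑ b₁, ∑ b₂, h b₁ b₂ • Matrix.vecMulVec (L b₁) (L b₂))
              - (∑ b₁, ∑ b₂, h b₁ b₂ • Matrix.vecMulVec (L b₁) (L b₂)) * Matrix.diagonal (fun x => lam (pr x)))
        - ∑ b, ℓ b • ∑ s, lam s • Rl s b := by
  rw [defect_eq_commutator_add_root]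
  abel

end Summit.QuantumFields.BalabanUV.Beta.FP.TowerK2bDefectSplit

end
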